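import Literature.AlgebraicGeometry.Frobenioids.Prop25Sub
import HarnessLib

/-!
# [FrdI] Proposition 2.5 (iii), sub-DAG row P25-L01 — the four-fold factorisation: discharge of
# `FrdI.P25.FourFoldFactorisation`

Mochizuki, *The geometry of Frobenioids I: the general theory*, Kyushu J. Math. **62** (2008)
293–400, §2, proof of Proposition 2.5 (iii), p. 49 ll. 21–26 [cite: MochizukiFrdI2008, Prop. 2.5(iii) p.49]:
"By applying the factorizations of Definition 1.3, (iv), (a); (v), (c), together with the bijection of
assertion (i) …, we conclude that every morphism `φ` of `C` admits a factorization `φ = α ∘ β ∘ γ ∘ δ`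
in `C`, where `α` is a pull-back morphism; `β` is a base-identity pre-step endomorphism …; `γ` is an
isometric pre-step; `δ` is a morphism of Frobenius type."
PROOF-ONLY companion of `Prop25Sub.lean` (row P25-L01, holder/typer abc-iut-L1-t2): Def. 1.3 (iv)(a)
(`hF.iv_a_exists`: pull-back ∘ pre-step ∘ Frobenius type), Def. 1.3 (v)(c) (`hF.v_c_exists`: the
pre-step is co-angular pre-step ∘ isometric pre-step), and — the use of "(i)", i.e. of metric triviality
and `Aut`-ampleness — the co-angular pre-step `Z → Y` is an isomorphism `Z ≅ Y` (metric triviality)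
corrected by an automorphism of `Z` (Aut-ampleness) to a base-identity pre-step endomorphism of `Z`; the
isomorphism is absorbed into the pull-back morphism.  No new definitions.
-/

namespace Literature.AlgebraicGeometry.Frobenioids

open CategoryTheory Opposite

namespace FrdI.P25

open PreFrobenioid

universe w v v' u u'

variable {D : Type u} [Category.{v} D] {Φ : Dᵒᵖ ⥤ CommMonCat.{w}}
  {C : Type u'} [Category.{v'} C] {F : C ⥤ ElemFrobenioid Φ}

/-- In a Frobenioid of metrically trivial and `Aut`-ample type, a co-angular pre-step `α' : Z → Y` is
`β₀ ≫ ι` with `β₀ ∈ O^▷(Z)` a base-identity pre-step endomorphism and `ι : Z ⥲ Y` an isomorphism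
("the bijection of assertion (i)", p. 49). [cite: MochizukiFrdI2008, Prop. 2.5(iii) p.49] -/
theorem exists_endo_iso_of_isCoAngularPreStep (hF : IsFrobenioid F)
    (hmt : IsOfType (IsMetricallyTrivial F)) (haa : IsOfType (IsAutAmple F)) {Z Y : C}
    {α' : Z ⟶ Y} (hα' : IsCoAngularPreStep F α') :
    ∃ (β₀ : Z ⟶ Z) (ι : Z ≅ Y), (β₀ : End Z) ∈ endSubmonoid F Z ∧ β₀ ≫ ι.hom = α' := by
  have hP := hF.isPreFrobenioid
  obtain ⟨e⟩ := hmt Z α' hα'.1 hα'.2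
  -- correct the base of `α' ≫ e` by an automorphism of `Z`
  have hb : IsBaseIso F (α' ≫ e.hom) := IsBaseIso.comp F hα'.2.2 (isBaseIso_of_isIso F e.hom)
  obtain ⟨a, ha⟩ := haa Z (@asIso D _ _ _ (Base F (α' ≫ e.hom)) hb)
  have hab : Base F a.hom = Base F (α' ≫ e.hom) := congrArg Iso.hom ha
  refine ⟨(α' ≫ e.hom) ≫ a.inv, a ≪≫ e.symm, ⟨?_, ?_⟩, ?_⟩
  · show Base F ((α' ≫ e.hom) ≫ a.inv) = 𝟙 _
    rw [base_comp, ← hab, ← base_comp, a.hom_inv_id, base_id]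
  · exact IsLinear.comp F (IsLinear.comp F hα'.2.1 (isLinear_of_isIso F e.hom)) (isLinear_of_isIso F a.inv)
  · simp

/-- **Row P25-L01 `FourFoldFactorisation` DISCHARGED**. [cite: MochizukiFrdI2008, Prop. 2.5(iii) p.49] -/
theorem fourFoldFactorisation_holds : FourFoldFactorisation F := by
  intro hS A B φ
  have hF := hS.isFrobenioid
  obtain ⟨X, Y, δ, β, α, hfac, hδ, hβ, hα⟩ := hF.iv_a_exists φ
  obtain ⟨Z, γ, α', hfac', hγ, hα'⟩ := hF.v_c_exists β hβ
  obtain ⟨β₀, ι, hβ₀, hι⟩ :=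
    exists_endo_iso_of_isCoAngularPreStep hF hS.metricallyTrivial hS.autAmple hα'
  refine ⟨X, Z, δ, γ, β₀, ι.hom ≫ α, hδ, hγ, hβ₀,
    IsPullbackMorphism.comp F (isPullbackMorphism_of_isIso F ι.hom) hα, ?_⟩
  rw [← hfac, ← hfac', ← hι]
  simp only [Category.assoc]

/-- `FourFoldFactorisation` — `_holds` alias of `fourFoldFactorisation_holds` above under the fact's exact name (appended
2026-08-28, D-0026 bookkeeping: the proof term is the existing theorem of this file; no statement,
definition or attribute is edited; no new named fact; the ledger's debt table listed the fact
unproved). [cite: MochizukiFrdI2008, Prop. 2.5(iii) p.49] -/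
theorem _root_.Literature.AlgebraicGeometry.Frobenioids.FrdI.P25.FourFoldFactorisation_holds :
    FourFoldFactorisation F :=
  _root_.Literature.AlgebraicGeometry.Frobenioids.FrdI.P25.fourFoldFactorisation_holds (F := F)

end FrdI.P25

end Literature.AlgebraicGeometry.Frobenioids
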